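import Literature.Probability.RandomPlanarGeometry.KernelConvergence
import Literature.Analysis.Complex.UpperHalfReflection
import Mathlib.Analysis.Complex.RemovableSingularity
import HarnessLib

/-!
# The Schwarz reflection `E_B` of the map `Φ_B` of a half-plane hull on `ℂ ∖ (B ∪ B̄)`

G. F. Lawler, *Conformally Invariant Processes in the Plane*, AMS (2005), §3.4, proof of
Prop. 3.36: a Riemann map `g : ℍ ∖ A → ℍ` with `g → ∞` at `∞`, `A ⊆ B(0, r)`, extends by the
Schwarz reflection principle to a conformal transformation of `{|z| > r}` with
`g(z̄) = conj g(z)`, and `f(z) = 1/g(1/z)` expanded about the origin gives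
`g(z) = b₋₁ z + b₀ + b₁ z⁻¹ + ⋯` with real `b_j`; `g_A` is the choice `b₋₁ = 1`, `b₀ = 0`. For the
maps `Φ_B : ℍ ∖ B → ℍ` of the tree (`IsRestrictionMap`, `RestrictionHulls`; normalized instead by
`Φ_B(0) = 0`, `Φ_B(z)/z → 1`; [LSW] p. 12: "the maps may be extended to a neighborhood of `0` by
Schwarz reflection in the real line") we CONSTRUCT the global extension across all of `ℝ ∖ B`
and its normalization at `∞`:

* `symmDomain B = {z : z ∉ B, z̄ ∉ B}` — the open symmetric set `ℂ ∖ (B ∪ B̄)` (it contains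
  `ℍ ∖ B`, its mirror image, and `ℝ ∖ B`);
* `hullExt Φ : ℂ → ℂ` — the reflection of `Φ` across `ℝ ∖ B`
  (`Literature.Analysis.Complex.schwarzExt (symmDomain B) Φ`), **holomorphic on `symmDomain B`**
  (`differentiableOn_hullExt`), equal to `Φ` on `ℍ ∖ B`, symmetric, real on `ℝ ∖ B`, receiving
  the boundary values of `Φ` (`tendsto_hullExt_ofReal`), with `‖(hullExt Φ)'‖ ≤ 2` on `B(x, r/2)`
  for real `x` with `B(x, r) ∩ B = ∅` (`norm_deriv_hullExt_le_two`, from `im Φ ≤ im`,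
  `IsRestrictionMap.im_le_im`, and Schwarz–Pick);
* for `*`-hulls: `hullExt Φ 0 = 0` and `(hullExt Φ)'(0) = Φ'_B(0)` (the number
  `HasRestrictionDeriv B Φ d`; `hasDerivAt_hullExt_zero`);
* the inverse at `∞`: `Φ.symm → ∞`, `Φ.symm ζ - ζ → -L`, `Φ.symm ζ / ζ → 1` as `ζ → ∞` in `ℍ`
  (`IsRestrictionMap.tendsto_symm_cocompact`, `…_sub_self`, `…_div`);
* **the expansion at `∞`**: `hullExt Φ z / z → 1` in ALL directions (`tendsto_hullExt_div`) and
  **`hullExt Φ z - z → L`** for a real constant `L = hullShift Φ` (`tendsto_hullExt_sub_self`;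
  the function `ζ ↦ E(1/ζ) - 1/ζ = o(1/ζ)` has a removable singularity at `0`), so that
  `hullExt Φ - L` is the hydrodynamically normalized map `g_B` ("`g_A(z) - z → 0`") and
  `Φ_B = g_B - g_B(0)` as in [LSW] §2.

The tree's earlier LOCAL construction `Literature.Probability.RandomPlanarGeometry.reflectExt`
(`KernelConvergence.lean`: the reflection of `Φ` on a disc `B(0, r)` with `B(0, 2r) ∩ A = ∅`, by
`Classical.choose` from `IsRestrictionMap.exists_extension`) is the special case near `0`: the
bridge `hullExt_eq_reflectExt` identifies the two on `B(0, r)` (identity theorem), so that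
`reflectExt_zero`, `deriv_reflectExt_zero`, `norm_reflectExt_le` transfer and the librarian may
retire one construction.

## References

* G. F. Lawler, *Conformally Invariant Processes in the Plane* (2005), §3.4, Prop. 3.36 and its
  proof (the set `A*`, p. 68) [Lawler2005].
* G. F. Lawler, O. Schramm, W. Werner, *Conformal restriction: the chordal case* (2003), §2
  pp. 7–8 [LawlerSchrammWerner2003Restriction].
-/

noncomputable section

open Set Filter Metric Bornology Function
open _root_.Complex _root_.Topology
open UpperHalfPlane (upperHalfPlaneSet isOpen_upperHalfPlaneSet)
open Literature.Analysis.Complex (schwarzExt)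
open scoped ComplexConjugate

namespace Literature.Probability.RandomPlanarGeometry

variable {B : Set ℂ} {Φ : ConformalEquiv (upperHalfPlaneSet \ B) upperHalfPlaneSet}

/-! ### The symmetric domain `ℂ ∖ (B ∪ B̄)` -/

/-- **The symmetric domain** `Ω_B = ℂ ∖ (B ∪ B̄) = {z : z ∉ B ∧ z̄ ∉ B}` of a set `B ⊆ ℍ̄` — for
closed `B` this is `ℂ ∖ B*` with `B*` the closure of `{z : z ∈ B or z̄ ∈ B}` of Lawler (2005),
p. 68 (before Prop. 3.36); the largest set across which `Φ_B` reflects (Lawler's proof of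
Prop. 3.36 reflects across `{|z| > r}` only). [folklore] -/
def symmDomain (B : Set ℂ) : Set ℂ := {z | z ∉ B ∧ conj z ∉ B}

/-- Membership in the symmetric domain. [folklore] -/
theorem mem_symmDomain_iff {z : ℂ} : z ∈ symmDomain B ↔ z ∉ B ∧ conj z ∉ B := Iff.rfl

/-- The symmetric domain is symmetric under conjugation. [folklore] -/
theorem conj_mem_symmDomain {z : ℂ} (hz : z ∈ symmDomain B) : conj z ∈ symmDomain B :=
  ⟨hz.2, by rw [conj_conj]; exact hz.1⟩

/-- The symmetric domain of a closed set is open. [folklore] -/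
theorem isOpen_symmDomain (hB : IsClosed B) : IsOpen (symmDomain B) :=
  (hB.isOpen_compl).inter (hB.isOpen_compl.preimage continuous_conj)

/-- A real point lies in the symmetric domain iff it is not in `B`. [folklore] -/
theorem ofReal_mem_symmDomain_iff {x : ℝ} : (x : ℂ) ∈ symmDomain B ↔ (x : ℂ) ∉ B := by
  rw [mem_symmDomain_iff, conj_ofReal, and_self]

/-- For `B ⊆ ℍ̄`, a point of the open upper half-plane off `B` lies in the symmetric domain (its
conjugate has negative imaginary part, so is not in `B`). [folklore] -/
theorem IsBoundedHull.mem_symmDomain_of_mem_diff (hB : IsBoundedHull B) {z : ℂ}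
    (hz : z ∈ upperHalfPlaneSet \ B) : z ∈ symmDomain B := by
  refine ⟨hz.2, fun h ↦ ?_⟩
  have h1 := hB.im_nonneg h
  rw [conj_im] at h1
  have h2 : 0 < z.im := hz.1
  linarith

/-- For `B ⊆ ℍ̄`, `symmDomain B ∩ ℍ = ℍ ∖ B`. [folklore] -/
theorem IsBoundedHull.symmDomain_inter_eq (hB : IsBoundedHull B) :
    symmDomain B ∩ {w : ℂ | 0 < w.im} = upperHalfPlaneSet \ B := by
  ext z
  constructor
  · rintro ⟨hz, hzim⟩
    exact ⟨hzim, hz.1⟩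
  · intro hz
    exact ⟨hB.mem_symmDomain_of_mem_diff hz, hz.1⟩

/-- A disc about a real point missing `B` lies in the symmetric domain (discs about real points
are symmetric). [folklore] -/
theorem ball_subset_symmDomain {x r : ℝ} (h : Disjoint (ball (x : ℂ) r) B) :
    ball (x : ℂ) r ⊆ symmDomain B := by
  intro z hz
  refine ⟨Set.disjoint_left.1 h hz, Set.disjoint_left.1 h ?_⟩
  rw [mem_ball] at hz ⊢
  rwa [← conj_ofReal x, dist_conj_conj]

/-! ### The reflected map `E_B` -/

/-- **The Schwarz reflection `E_B` of a restriction map** across `ℝ ∖ B`, a function on `ℂ`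
(meaningful on `symmDomain B`): `Φ` on `ℍ ∖ B`, boundary values on `ℝ ∖ B`, `conj ∘ Φ ∘ conj`
below. [cite: Lawler2005, §3.4 proof of Prop. 3.36] -/
def hullExt (Φ : ConformalEquiv (upperHalfPlaneSet \ B) upperHalfPlaneSet) : ℂ → ℂ :=
  schwarzExt (symmDomain B) Φ

section Basic

variable (hB : IsBoundedHull B) (hΦ : IsRestrictionMap B Φ)
include hB hΦ

omit hΦ in
/-- The hypotheses of the reflection package: `Φ` is holomorphic on `symmDomain B ∩ ℍ = ℍ ∖ B`.
[folklore] -/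
theorem differentiableOn_coe_symmDomain :
    DifferentiableOn ℂ Φ (symmDomain B ∩ {w : ℂ | 0 < w.im}) := by
  rw [hB.symmDomain_inter_eq]; exact Φ.differentiableOn_coe

/-- The hypotheses of the reflection package: `0 < im Φ ≤ im` on `ℍ ∖ B`
(`IsRestrictionMap.im_le_im`). [cite: LawlerSchrammWerner2003Restriction, §2 p. 7 (before (2.4))] -/
theorem im_pos_and_im_le :
    ∀ z ∈ symmDomain B ∩ {w : ℂ | 0 < w.im}, 0 < (Φ z).im ∧ (Φ z).im ≤ z.im := by
  rw [hB.symmDomain_inter_eq]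
  exact fun z hz ↦ ⟨(Φ.mapsTo hz : Φ z ∈ upperHalfPlaneSet), hΦ.im_le_im hB.1 hz⟩

/-- **`E_B` is holomorphic on `ℂ ∖ (B ∪ B̄)`.** [cite: Lawler2005, §3.4 proof of Prop. 3.36] -/
theorem differentiableOn_hullExt : DifferentiableOn ℂ (hullExt Φ) (symmDomain B) :=
  Literature.Analysis.Complex.differentiableOn_schwarzExt (isOpen_symmDomain hB.isClosed)
    (fun _ hz ↦ conj_mem_symmDomain hz) (differentiableOn_coe_symmDomain hB)
    (im_pos_and_im_le hB hΦ)

omit hB hΦ in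
/-- `E_B = Φ` on `ℍ ∖ B` (indeed on `{im > 0}`). [folklore] -/
theorem hullExt_of_im_pos {z : ℂ} (hz : 0 < z.im) : hullExt Φ z = Φ z :=
  Literature.Analysis.Complex.schwarzExt_of_im_pos hz

omit hB hΦ in
/-- `E_B = Φ` on `ℍ ∖ B`. [folklore] -/
theorem hullExt_of_mem_diff {z : ℂ} (hz : z ∈ upperHalfPlaneSet \ B) : hullExt Φ z = Φ z :=
  hullExt_of_im_pos hz.1

omit hB hΦ in
/-- Below the axis, `E_B = conj ∘ Φ ∘ conj`. [folklore] -/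
theorem hullExt_of_im_neg {z : ℂ} (hz : z.im < 0) : hullExt Φ z = conj (Φ (conj z)) :=
  Literature.Analysis.Complex.schwarzExt_of_im_neg hz

/-- **`E_B` commutes with conjugation** on `symmDomain B`. [folklore] -/
theorem hullExt_conj {z : ℂ} (hz : z ∈ symmDomain B) : hullExt Φ (conj z) = conj (hullExt Φ z) :=
  Literature.Analysis.Complex.schwarzExt_conj (isOpen_symmDomain hB.isClosed)
    (differentiableOn_coe_symmDomain hB) (im_pos_and_im_le hB hΦ) hz

/-- `E_B` is real on `ℝ ∖ B`. [folklore] -/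
theorem hullExt_ofReal_im {x : ℝ} (hx : (x : ℂ) ∉ B) : (hullExt Φ x).im = 0 :=
  Literature.Analysis.Complex.schwarzExt_ofReal_im (isOpen_symmDomain hB.isClosed)
    (differentiableOn_coe_symmDomain hB) (im_pos_and_im_le hB hΦ) (ofReal_mem_symmDomain_iff.2 hx)

/-- **Boundary values**: `Φ → E_B(x)` at a real point `x ∉ B`, from `ℍ ∖ B`. [folklore] -/
theorem tendsto_hullExt_ofReal {x : ℝ} (hx : (x : ℂ) ∉ B) :
    Tendsto Φ (𝓝[upperHalfPlaneSet \ B] (x : ℂ)) (𝓝 (hullExt Φ x)) := by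
  have h := Literature.Analysis.Complex.tendsto_schwarzExt_ofReal (isOpen_symmDomain hB.isClosed)
    (differentiableOn_coe_symmDomain hB) (im_pos_and_im_le hB hΦ) (ofReal_mem_symmDomain_iff.2 hx)
  rwa [hB.symmDomain_inter_eq] at h

omit hB hΦ in
/-- `im E_B > 0` on `ℍ ∖ B`. [folklore] -/
theorem hullExt_im_pos {z : ℂ} (hz : z ∈ upperHalfPlaneSet \ B) : 0 < (hullExt Φ z).im := by
  rw [hullExt_of_mem_diff hz]; exact Φ.mapsTo hz

/-- `im E_B < 0` on the mirror image of `ℍ ∖ B`. [folklore] -/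
theorem hullExt_im_neg {z : ℂ} (hz : z ∈ symmDomain B) (hzim : z.im < 0) : (hullExt Φ z).im < 0 :=
  Literature.Analysis.Complex.schwarzExt_im_neg (fun _ hz ↦ conj_mem_symmDomain hz)
    (im_pos_and_im_le hB hΦ) hz hzim

/-- `im E_B(z) ≤ im z` on `ℍ ∖ B`. [cite: LawlerSchrammWerner2003Restriction, §2 p. 7 (before (2.4))] -/
theorem hullExt_im_le {z : ℂ} (hz : z ∈ upperHalfPlaneSet \ B) : (hullExt Φ z).im ≤ z.im := by
  rw [hullExt_of_mem_diff hz]; exact hΦ.im_le_im hB.1 hz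

/-- **Uniform derivative bound near good real points**: `‖E_B'(z)‖ ≤ 2` on `B(x, r/2)` if
`B(x, r) ∩ B = ∅`, `x ∈ ℝ` (Schwarz–Pick). [folklore] -/
theorem norm_deriv_hullExt_le_two {x r : ℝ} (hr : Disjoint (ball (x : ℂ) r) B) {z : ℂ}
    (hz : z ∈ ball (x : ℂ) (r / 2)) : ‖deriv (hullExt Φ) z‖ ≤ 2 :=
  Literature.Analysis.Complex.norm_deriv_schwarzExt_le_two (isOpen_symmDomain hB.isClosed)
    (fun _ hz ↦ conj_mem_symmDomain hz) (differentiableOn_coe_symmDomain hB)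
    (im_pos_and_im_le hB hΦ) (ball_subset_symmDomain hr) hz

/-- `E_B` is `2`-Lipschitz on `B(x, r/2)` if `B(x, r) ∩ B = ∅`, `x ∈ ℝ`. [folklore] -/
theorem lipschitzOnWith_hullExt {x r : ℝ} (hr : Disjoint (ball (x : ℂ) r) B) :
    LipschitzOnWith 2 (hullExt Φ) (ball (x : ℂ) (r / 2)) :=
  Literature.Analysis.Complex.lipschitzOnWith_schwarzExt (isOpen_symmDomain hB.isClosed)
    (fun _ hz ↦ conj_mem_symmDomain hz) (differentiableOn_coe_symmDomain hB)
    (im_pos_and_im_le hB hΦ) (ball_subset_symmDomain hr)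

/-- `E_B` is differentiable at every point of the symmetric domain. [folklore] -/
theorem differentiableAt_hullExt {z : ℂ} (hz : z ∈ symmDomain B) : DifferentiableAt ℂ (hullExt Φ) z :=
  (differentiableOn_hullExt hB hΦ).differentiableAt ((isOpen_symmDomain hB.isClosed).mem_nhds hz)

end Basic

/-! ### `*`-hulls: the value and the derivative at `0` -/

section Star

variable (hB : IsStarHull B) (hΦ : IsRestrictionMap B Φ)
include hB hΦ

omit hΦ in
/-- `0 ∈ symmDomain B` for a `*`-hull. [folklore] -/
theorem IsStarHull.zero_mem_symmDomain : (0 : ℂ) ∈ symmDomain B :=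
  ⟨hB.zero_notMem, by rw [map_zero]; exact hB.zero_notMem⟩

/-- **`E_B(0) = 0`**: the boundary value of `Φ_B` at `0` is `0`. [cite: LawlerSchrammWerner2003Restriction, §2 p. 8 (Φ_A(0) = 0)] -/
theorem hullExt_zero : hullExt Φ 0 = 0 := by
  have h0 : ((0 : ℝ) : ℂ) ∉ B := by rw [ofReal_zero]; exact hB.zero_notMem
  have h1 := tendsto_hullExt_ofReal hB.isBoundedHull hΦ h0
  rw [ofReal_zero] at h1
  haveI : (𝓝[upperHalfPlaneSet \ B] (0 : ℂ)).NeBot :=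
    mem_closure_iff_nhdsWithin_neBot.1 hB.zero_mem_closure_diff
  exact tendsto_nhds_unique h1 hΦ.1

/-- **`E_B'(0) = Φ'_B(0)`**: the derivative of the reflected map at `0` is the number
`HasRestrictionDeriv B Φ d` (the limit of `Φ(z)/z` inside `ℍ ∖ B`).
[cite: LawlerSchrammWerner2003Restriction, §2 (2.4) p. 7] -/
theorem hasDerivAt_hullExt_zero {d : ℝ} (hd : HasRestrictionDeriv B Φ d) :
    HasDerivAt (hullExt Φ) d 0 := by
  have hdiff := differentiableAt_hullExt hB.isBoundedHull hΦ (hB.zero_mem_symmDomain)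
  have hD := hdiff.hasDerivAt
  suffices heq : deriv (hullExt Φ) 0 = d by rwa [heq] at hD
  -- the difference quotient tends to the derivative along `ℍ ∖ B ∋ z → 0`, where it is `Φ z / z`
  have h1 : Tendsto (fun z ↦ (hullExt Φ z - hullExt Φ 0) / (z - 0)) (𝓝[upperHalfPlaneSet \ B] 0)
      (𝓝 (deriv (hullExt Φ) 0)) := by
    have := hD.tendsto_slope
    rw [show upperHalfPlaneSet \ B = (upperHalfPlaneSet \ B) ∩ {(0 : ℂ)}ᶜ by
      rw [inter_eq_left.2]; exact fun z hz h ↦ absurd hz.1 (by rw [mem_singleton_iff.1 h]; simp [upperHalfPlaneSet])]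
    refine (this.mono_left (nhdsWithin_mono _ inter_subset_right)).congr' ?_
    filter_upwards with z
    rw [slope_def_field]
  have h2 : Tendsto (fun z ↦ (hullExt Φ z - hullExt Φ 0) / (z - 0)) (𝓝[upperHalfPlaneSet \ B] 0)
      (𝓝 (d : ℂ)) := by
    refine (hd.congr' ?_)
    filter_upwards [self_mem_nhdsWithin] with z hz
    rw [hullExt_zero hB hΦ, hullExt_of_mem_diff hz, sub_zero, sub_zero]
  haveI : (𝓝[upperHalfPlaneSet \ B] (0 : ℂ)).NeBot :=
    mem_closure_iff_nhdsWithin_neBot.1 hB.zero_mem_closure_diff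
  exact tendsto_nhds_unique h1 h2

/-- `deriv E_B 0 = Φ'_B(0)`. [cite: LawlerSchrammWerner2003Restriction, §2 (2.4) p. 7] -/
theorem deriv_hullExt_zero {d : ℝ} (hd : HasRestrictionDeriv B Φ d) : deriv (hullExt Φ) 0 = d :=
  (hasDerivAt_hullExt_zero hB hΦ hd).deriv


/-- **Bridge to the local reflection `reflectExt` of `KernelConvergence`**: on a disc `B(0, r)`
with `B(0, 2r) ∩ B = ∅` the global reflection `hullExt Φ` agrees with `reflectExt hB hΦ hr` (both
are holomorphic on the ball and equal to `Φ` on the open upper half-disc: identity theorem).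
[folklore] -/
theorem hullExt_eq_reflectExt {r : ℝ} (hr : Disjoint (ball (0 : ℂ) (2 * r)) B) :
    EqOn (hullExt Φ) (reflectExt hB hΦ hr) (ball 0 r) := by
  rcases le_or_gt r 0 with hr0 | hr0
  · intro z hz
    exact absurd (pos_of_mem_ball hz) (not_lt.2 hr0)
  have hsub : ball (0 : ℂ) r ⊆ symmDomain B := by
    have h2 : ball ((0 : ℝ) : ℂ) (2 * r) ⊆ symmDomain B := ball_subset_symmDomain (by simpa using hr)
    rw [ofReal_zero] at h2
    exact (ball_subset_ball (by linarith)).trans h2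
  have h1 : AnalyticOnNhd ℂ (hullExt Φ) (ball 0 r) :=
    ((differentiableOn_hullExt hB.isBoundedHull hΦ).mono hsub).analyticOnNhd isOpen_ball
  have h2 : AnalyticOnNhd ℂ (reflectExt hB hΦ hr) (ball 0 r) :=
    (differentiableOn_reflectExt hB hΦ hr).analyticOnNhd isOpen_ball
  -- a point of the upper half-disc where the two agree nearby
  set z₁ : ℂ := I * ((r / 2 : ℝ) : ℂ) with hz₁
  have hz₁im : 0 < z₁.im := by simp [hz₁, hr0]
  have hz₁r : z₁ ∈ ball (0 : ℂ) r := by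
    rw [mem_ball_zero_iff, hz₁, norm_mul, norm_I, one_mul, norm_real, Real.norm_of_nonneg (by positivity)]
    linarith
  have hev : hullExt Φ =ᶠ[𝓝 z₁] reflectExt hB hΦ hr := by
    filter_upwards [(isOpen_upperHalfPlaneSet.inter isOpen_ball).mem_nhds ⟨(hz₁im : z₁ ∈ upperHalfPlaneSet), hz₁r⟩]
      with z hz
    rw [hullExt_of_im_pos hz.1, reflectExt_eq hB hΦ hr hz]
  exact h1.eqOn_of_preconnected_of_eventuallyEq h2 (convex_ball _ _).isPreconnected hz₁r hev

end Star

/-! ### The expansion at `∞`: `E_B(z)/z → 1` and `E_B(z) - z → L` -/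

section Infinity

variable (hB : IsBoundedHull B) (hΦ : IsRestrictionMap B Φ)
include hB hΦ

omit hΦ in
/-- Far out, every point is in the symmetric domain. [folklore] -/
theorem exists_forall_mem_symmDomain : ∃ R : ℝ, 0 < R ∧ ∀ z : ℂ, R < ‖z‖ → z ∈ symmDomain B := by
  obtain ⟨R, hR⟩ := hB.1.subset_ball 0
  refine ⟨max R 1, lt_max_of_lt_right one_pos, fun z hz ↦ ⟨fun h ↦ ?_, fun h ↦ ?_⟩⟩
  · have := mem_ball_zero_iff.1 (hR h)
    linarith [le_max_left R 1]
  · have := mem_ball_zero_iff.1 (hR h)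
    rw [norm_conj] at this
    linarith [le_max_left R 1]

omit hB in
/-- **`Φ(z)/z → 1` uniformly far out** (`ε`–`R` form of the normalization at `∞` on `ℍ ∖ B`).
[folklore] -/
theorem exists_forall_norm_div_sub_one_lt {ε : ℝ} (hε : 0 < ε) :
    ∃ R : ℝ, 0 < R ∧ ∀ z ∈ upperHalfPlaneSet \ B, R < ‖z‖ → ‖Φ z / z - 1‖ < ε := by
  have hev := hΦ.2 (ball_mem_nhds (1 : ℂ) hε)
  rw [← cobounded_eq_cocompact] at hev
  obtain ⟨R, -, hR⟩ := ((hasBasis_cobounded_compl_closedBall (0 : ℂ)).inf_principal _).eventually_iff.1 hev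
  refine ⟨max R 1, lt_max_of_lt_right one_pos, fun z hz hzR ↦ ?_⟩
  have := hR ⟨by simp; linarith [le_max_left R 1], hz⟩
  simpa [dist_eq_norm] using this

/-- **`E_B(z)/z → 1` in all directions** (above by hypothesis, below by symmetry, on the real
axis by passing to boundary values). [cite: Lawler2005, §3.4 proof of Prop. 3.36] -/
theorem exists_forall_norm_hullExt_div_sub_one_le {ε : ℝ} (hε : 0 < ε) :
    ∃ R : ℝ, 0 < R ∧ ∀ z : ℂ, R < ‖z‖ → ‖hullExt Φ z / z - 1‖ ≤ ε := by
  obtain ⟨R₁, hR₁, h₁⟩ := exists_forall_norm_div_sub_one_lt hΦ hε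
  obtain ⟨R₂, hR₂, h₂⟩ := exists_forall_mem_symmDomain hB
  refine ⟨max R₁ R₂, lt_max_of_lt_left hR₁, fun z hz ↦ ?_⟩
  have hz₁ : R₁ < ‖z‖ := lt_of_le_of_lt (le_max_left _ _) hz
  have hz₂ : R₂ < ‖z‖ := lt_of_le_of_lt (le_max_right _ _) hz
  have hzΩ := h₂ z hz₂
  rcases lt_trichotomy z.im 0 with hneg | h0 | hpos
  · -- below: `E(z)/z = conj (Φ(z̄)/z̄)`
    have hcz : conj z ∈ upperHalfPlaneSet \ B := ⟨by show 0 < (conj z).im; rw [conj_im]; linarith, hzΩ.2⟩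
    rw [hullExt_of_im_neg hneg]
    have : conj (Φ (conj z)) / z - 1 = conj (Φ (conj z) / conj z - 1) := by
      rw [map_sub, map_one, map_div₀, conj_conj]
    rw [this, norm_conj]
    exact (h₁ _ hcz (by rwa [norm_conj])).le
  · -- on the real axis: boundary values
    have hzr : z = ((z.re : ℝ) : ℂ) := Complex.ext rfl (by simp [h0])
    have hxB : ((z.re : ℝ) : ℂ) ∉ B := by rw [← hzr]; exact hzΩ.1
    have hT := tendsto_hullExt_ofReal hB hΦ hxB
    rw [← hzr] at hT
    have hz0 : z ≠ 0 := by rintro rfl; simp at hz; linarith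
    have hT' : Tendsto (fun w ↦ ‖Φ w / w - 1‖) (𝓝[upperHalfPlaneSet \ B] z) (𝓝 ‖hullExt Φ z / z - 1‖) := by
      refine ((continuous_norm.tendsto _).comp (((hT.div ?_ hz0).sub tendsto_const_nhds)))
      exact (continuous_id.tendsto z).mono_left nhdsWithin_le_nhds
    haveI : (𝓝[upperHalfPlaneSet \ B] z).NeBot := by
      rw [← hB.symmDomain_inter_eq, hzr]
      exact Literature.Analysis.Complex.neBot_nhdsWithin_ofReal (isOpen_symmDomain hB.isClosed) (by rw [← hzr]; exact hzΩ)
    refine le_of_tendsto hT' ?_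
    have hopen : IsOpen {w : ℂ | R₁ < ‖w‖} := isOpen_lt continuous_const continuous_norm
    filter_upwards [mem_nhdsWithin_of_mem_nhds (hopen.mem_nhds hz₁), self_mem_nhdsWithin] with w hw hw'
    exact (h₁ w hw' hw).le
  · rw [hullExt_of_im_pos hpos]
    exact (h₁ z ⟨hpos, hzΩ.1⟩ hz₁).le

/-- `E_B(z)/z → 1` as `z → ∞` (all directions). [cite: Lawler2005, §3.4 proof of Prop. 3.36] -/
theorem tendsto_hullExt_div : Tendsto (fun z ↦ hullExt Φ z / z) (cocompact ℂ) (𝓝 1) := by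
  rw [← cobounded_eq_cocompact, Metric.tendsto_nhds]
  intro ε hε
  obtain ⟨R, -, hR⟩ := exists_forall_norm_hullExt_div_sub_one_le hB hΦ (half_pos hε)
  refine (hasBasis_cobounded_compl_closedBall (0 : ℂ)).eventually_iff.2 ⟨R, trivial, fun z hz ↦ ?_⟩
  rw [dist_eq_norm]
  have hz' : R < ‖z‖ := by simpa using hz
  have := hR z hz'
  linarith

/-- **The hydrodynamic constant** `L = lim_{z → ∞} (E_B(z) - z)`, so that `E_B - L = g_B` has
`g_B(z) - z → 0` ([LSW] §2: `Φ_A = g_A - g_A(0)`, i.e. `L = -g_B(0)`). It is DEFINED as a limit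
(`limUnder` at `0` of the inverted function), proved to exist in `tendsto_hullExt_sub_self`; it
is `ℂ`-valued, and real by `hullShift_im`. [cite: LawlerSchrammWerner2003Restriction, §2 pp. 7–8 (g_A, Φ_A)] -/
def hullShift (Φ : ConformalEquiv (upperHalfPlaneSet \ B) upperHalfPlaneSet) : ℂ :=
  limUnder (𝓝[≠] (0 : ℂ)) fun ζ ↦ hullExt Φ ζ⁻¹ - ζ⁻¹

/-- **`E_B(z) - z → L` at `∞`**: the inverted function `M(ζ) = E_B(1/ζ) - 1/ζ` is holomorphic on a
punctured disc about `0` with `ζ M(ζ) = (E_B(z) - z)/z → 0`, so `0` is a removable singularity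
(Mathlib's `Complex.tendsto_limUnder_of_differentiable_on_punctured_nhds_of_isLittleO`) and
`M → L`. [cite: Lawler2005, §3.4 proof of Prop. 3.36] -/
theorem tendsto_hullExt_sub_self :
    Tendsto (fun z ↦ hullExt Φ z - z) (cocompact ℂ) (𝓝 (hullShift Φ)) := by
  set M : ℂ → ℂ := fun ζ ↦ hullExt Φ ζ⁻¹ - ζ⁻¹ with hM
  obtain ⟨R, hR, hRΩ⟩ := exists_forall_mem_symmDomain hB
  -- `M` is holomorphic on the punctured disc `0 < |ζ| < 1/R`
  have hd : ∀ᶠ ζ in 𝓝[≠] (0 : ℂ), DifferentiableAt ℂ M ζ := by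
    have hmem : {(0 : ℂ)}ᶜ ∩ ball (0 : ℂ) R⁻¹ ∈ 𝓝[≠] (0 : ℂ) :=
      inter_mem_nhdsWithin _ (ball_mem_nhds (0 : ℂ) (inv_pos.2 hR))
    filter_upwards [hmem] with ζ hζ
    have hζ0 : ζ ≠ 0 := hζ.1
    have hz : R < ‖ζ⁻¹‖ := by
      have hζ2 := mem_ball_zero_iff.1 hζ.2
      rw [norm_inv]
      rwa [lt_inv_comm₀ hR (norm_pos_iff.2 hζ0)]
    have h1 : DifferentiableAt ℂ (hullExt Φ) ζ⁻¹ :=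
      differentiableAt_hullExt hB hΦ (hRΩ _ hz)
    exact (h1.comp ζ (differentiableAt_inv hζ0)).sub (differentiableAt_inv hζ0)
  -- `M ζ - M 0 = o(1/ζ)`: indeed `ζ (M ζ - M 0) → 0`
  have ho : (fun ζ ↦ M ζ - M 0) =o[𝓝[≠] (0 : ℂ)] fun ζ ↦ (ζ - 0)⁻¹ := by
    simp only [sub_zero]
    refine (Asymptotics.isLittleO_iff_tendsto' ?_).2 ?_
    · filter_upwards [self_mem_nhdsWithin] with ζ hζ h
      exact absurd (inv_eq_zero.1 h) hζ
    · -- `(M ζ - M 0) / ζ⁻¹ = ζ (M ζ - M 0) → 0`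
      have h1 : Tendsto (fun z ↦ hullExt Φ z / z - 1) (cocompact ℂ) (𝓝 0) := by
        have := (tendsto_hullExt_div hB hΦ).sub (tendsto_const_nhds (x := (1 : ℂ)))
        rwa [sub_self] at this
      have h2 : Tendsto (fun ζ : ℂ ↦ ζ⁻¹) (𝓝[≠] 0) (cocompact ℂ) := by
        rw [← cobounded_eq_cocompact]; exact tendsto_inv₀_nhdsNE_zero
      have h3 := h1.comp h2
      have h4 : Tendsto (fun ζ : ℂ ↦ ζ * M 0) (𝓝[≠] 0) (𝓝 0) := by
        have : Tendsto (fun ζ : ℂ ↦ ζ * M 0) (𝓝 0) (𝓝 (0 * M 0)) :=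
          ((continuous_id.mul continuous_const).tendsto 0)
        rw [zero_mul] at this
        exact this.mono_left nhdsWithin_le_nhds
      have h5 := h3.sub h4
      rw [sub_zero] at h5
      have hM0 : M 0 = hullExt Φ 0 := by simp [hM]
      refine h5.congr' ?_
      filter_upwards [self_mem_nhdsWithin] with ζ hζ
      have hζ0 : ζ ≠ 0 := hζ
      rw [hM0]
      simp only [comp_apply, hM]
      field_simp
  have hT := tendsto_limUnder_of_differentiable_on_punctured_nhds_of_isLittleO hd ho
  -- back to `z = 1/ζ → ∞`
  have hinv : Tendsto (fun z : ℂ ↦ z⁻¹) (cocompact ℂ) (𝓝[≠] 0) := by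
    rw [← cobounded_eq_cocompact]; exact tendsto_inv₀_cobounded'
  refine ((hT.comp hinv).congr fun z ↦ ?_)
  simp [hM]

/-- **The hydrodynamic constant is real** (`E_B` is real on the far real axis).
[cite: Lawler2005, §3.4 proof of Prop. 3.36] -/
theorem hullShift_im : (hullShift Φ).im = 0 := by
  obtain ⟨R, hR, hRΩ⟩ := exists_forall_mem_symmDomain hB
  -- along the real axis `x → +∞`, `E_B(x) - x` is real and tends to `L`
  have hcoe : Tendsto (fun x : ℝ ↦ (x : ℂ)) atTop (cocompact ℂ) := by
    rw [← cobounded_eq_cocompact, ← tendsto_norm_atTop_iff_cobounded]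
    simpa using tendsto_abs_atTop_atTop
  have h1 : Tendsto (fun x : ℝ ↦ (hullExt Φ x - x).im) atTop (𝓝 (hullShift Φ).im) :=
    (continuous_im.tendsto _).comp ((tendsto_hullExt_sub_self hB hΦ).comp hcoe)
  have h2 : Tendsto (fun x : ℝ ↦ (hullExt Φ x - x).im) atTop (𝓝 0) := by
    refine tendsto_const_nhds.congr' ?_
    filter_upwards [eventually_gt_atTop R] with x hx
    have hxΩ : (x : ℂ) ∈ symmDomain B := hRΩ x (by
      rw [norm_real, Real.norm_eq_abs]; exact lt_of_lt_of_le hx (le_abs_self x))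
    rw [sub_im, ofReal_im, sub_zero, hullExt_ofReal_im hB hΦ (ofReal_mem_symmDomain_iff.1 hxΩ)]
  exact tendsto_nhds_unique h1 h2

end Infinity


/-! ### The inverse map at `∞` -/

section Inverse

variable (hB : IsStarHull B) (hΦ : IsRestrictionMap B Φ)
include hB hΦ

/-- **Properness of `Φ_B⁻¹` at `∞`** for every restriction map of a `*`-hull (transferred from the
map of `IsStarHull.exists_restrictionMap_tendsto` by uniqueness of restriction maps). [folklore] -/
theorem IsRestrictionMap.tendsto_symm_cocompact :
    Tendsto Φ.symm (cocompact ℂ ⊓ 𝓟 upperHalfPlaneSet) (cocompact ℂ) := by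
  obtain ⟨Φ₀, hΦ₀, -, hinf, -⟩ := hB.exists_restrictionMap_tendsto
  obtain ⟨Φ₁, -, hU⟩ := IsStarHull.existsUnique_isRestrictionMap_holds hB
  have heq : EqOn Φ.symm Φ₀.symm upperHalfPlaneSet := fun w hw ↦ by
    have hz := Φ₀.symm_mapsTo hw
    have h1 : Φ (Φ₀.symm w) = w := by
      rw [hU Φ hΦ hz, ← hU Φ₀ hΦ₀ hz]; exact Φ₀.apply_symm_apply hw
    calc Φ.symm w = Φ.symm (Φ (Φ₀.symm w)) := by rw [h1]
      _ = Φ₀.symm w := Φ.symm_apply_apply hz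
  refine hinf.congr' ?_
  filter_upwards [mem_inf_of_right (mem_principal_self _)] with w hw using (heq hw).symm

/-- **`Φ_B⁻¹(ζ) - ζ → -L` at `∞`** (`L = hullShift Φ`): along `ζ → ∞` in `ℍ`, `z = Φ_B⁻¹(ζ) → ∞`
and `E_B(z) - z → L` with `E_B(z) = ζ`. [cite: LawlerSchrammWerner2003Restriction, §2 pp. 7–8 (g_A(z) − z → 0)] -/
theorem IsRestrictionMap.tendsto_symm_sub_self :
    Tendsto (fun ζ ↦ Φ.symm ζ - ζ) (cocompact ℂ ⊓ 𝓟 upperHalfPlaneSet) (𝓝 (-hullShift Φ)) := by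
  have h1 := (tendsto_hullExt_sub_self hB.isBoundedHull hΦ).comp (hΦ.tendsto_symm_cocompact hB)
  have h2 : ∀ᶠ ζ in cocompact ℂ ⊓ 𝓟 upperHalfPlaneSet,
      ((fun z ↦ hullExt Φ z - z) ∘ Φ.symm) ζ = ζ - Φ.symm ζ := by
    filter_upwards [mem_inf_of_right (mem_principal_self _)] with ζ hζ
    simp only [comp_apply]
    rw [hullExt_of_mem_diff (Φ.symm_mapsTo hζ), Φ.apply_symm_apply hζ]
  have h3 : Tendsto (fun ζ ↦ ζ - Φ.symm ζ) (cocompact ℂ ⊓ 𝓟 upperHalfPlaneSet) (𝓝 (hullShift Φ)) :=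
    h1.congr' h2
  have h4 := h3.neg
  refine h4.congr fun ζ ↦ ?_
  ring

/-- `Φ_B⁻¹(ζ)/ζ → 1` at `∞`. [folklore] -/
theorem IsRestrictionMap.tendsto_symm_div :
    Tendsto (fun ζ ↦ Φ.symm ζ / ζ) (cocompact ℂ ⊓ 𝓟 upperHalfPlaneSet) (𝓝 1) := by
  have h1 := hΦ.tendsto_symm_sub_self hB
  have hinv : Tendsto (fun ζ : ℂ ↦ ζ⁻¹) (cocompact ℂ ⊓ 𝓟 upperHalfPlaneSet) (𝓝 0) := by
    rw [← cobounded_eq_cocompact]; exact tendsto_inv₀_cobounded.mono_left inf_le_left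
  have h2 := h1.mul hinv
  rw [mul_zero] at h2
  have h3 : ∀ᶠ ζ in cocompact ℂ ⊓ 𝓟 upperHalfPlaneSet, (Φ.symm ζ - ζ) * ζ⁻¹ = Φ.symm ζ / ζ - 1 := by
    have hne : ∀ᶠ ζ in cocompact ℂ ⊓ 𝓟 upperHalfPlaneSet, ζ ≠ (0 : ℂ) :=
      mem_inf_of_left ((isCompact_singleton (x := (0 : ℂ))).compl_mem_cocompact)
    filter_upwards [hne] with ζ hζ
    field_simp
  have h4 := h2.congr' h3
  have h5 := h4.add (tendsto_const_nhds (x := (1 : ℂ)))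
  rw [zero_add] at h5
  exact h5.congr fun ζ ↦ by ring

end Inverse

end Literature.Probability.RandomPlanarGeometry
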